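import Summits.CriticalPhenomena.PercolationContinuityZ3.Theorems.PercGamblersRuinVerticalGamblersRuinStubExitTimeBound

/-!
# Route `PercGamblersRuin`, crux `VerticalGamblersRuin` (stmt-CriticalPhenomena-10642):
# the crux from annealed anti-concentration at one deterministic time (line `registered`, rev 8, lead c3)

Composition of the landed pieces of skeleton rev 7–8:
* the deterministic-time criterion `stub_DTC : DT → VerticalGamblersRuin` (p158839);
* the annealed EXIT-TIME BOUND `stub_exitTimeBound` (p163508; Lyons–Zheng forward/backward martingale
  decomposition: `stub_forwardKolmogorov` p160344, `stub_pathReversal` p162302, `stub_pathFunctionalBasics`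
  p160849): `∫_{0↔∞} deg·(1 - (𝒦^T_{(-m,m)} 1)(0)) dP_{p_c} ≤ 480·T/m²`;
* the kernel inequality `𝒦^T 1_A ≥ 𝒫^T 1_A - (𝒫^T 1 - 𝒦^T 1)` (linearity of the killed and unkilled
  averaging operators, `𝒦^T ≤ 𝒫^T` on `1 - 1_A ≥ 0`).
Result: `stub_VGRofAC : AC → VerticalGamblersRuin` and `DT_of_AC : AC → DT`, where AC is the statement of
the open stub `stub_antiConcentration` of the skeleton: "if `θ(p_c) > 0` there is `c > 0` such that for
every `C₀ > 0` there are `K ≥ 1`, `N` with: for all `n ≥ N` some `T` with `C₀ T ≤ c (Kn)²` has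
`2c ≤ ∫_{0↔∞} (𝒫_ω^T 1_{n ≤ x₀})(0) dP_{p_c}`" — annealed anti-concentration of the simple random walk on
the open cluster of a typical point at ONE deterministic time of diffusive order.  AC follows from
positive annealed diffusivity `liminf_T E[h_T²]/T > 0` (Paley–Zygmund with a fourth-moment bound); the
positivity of the diffusivity (= effective conductivity) of the would-be critical infinite cluster is the
research content that remains (Kipnis–Varadhan 1986, De Masi–Ferrari–Goldstein–Wick 1989 give `σ² ≥ 0`
θ-blind).

## References
* T. Lyons, W. Zheng, Astérisque 157–158 (1988) 249–271 (forward/backward martingale decomposition).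
* A. De Masi, P. A. Ferrari, S. Goldstein, W. D. Wick, J. Stat. Phys. 55 (1989) 787–855, §4.
* C. Kipnis, S. R. S. Varadhan, Comm. Math. Phys. 104 (1986) 1–19.
-/

noncomputable section

namespace Summit.CriticalPhenomena.PercolationContinuityZ3.Theorems.VerticalGamblersRuin

open MeasureTheory Filter Topology
open Literature.Probability.Percolation Literature.Probability.LatticeModels
open scoped Classical

namespace AntiConcentration

section Kernel

/-! ### Linearity of the unkilled averaging operator -/

variable {V : Type*} {N : V → Finset V} {Ψ : (V → ℝ) → V → ℝ}

/-- The unkilled averaging operator is subtractive. [folklore] -/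
theorem full_sub (hΨ : ∀ f x, Ψ f x = (∑ y ∈ N x, f y) / ((N x).card : ℝ)) (f g : V → ℝ) :
    (Ψ fun y => f y - g y) = fun x => Ψ f x - Ψ g x := by
  funext x
  rw [hΨ, hΨ, hΨ, Finset.sum_sub_distrib, sub_div]

/-- Iterates of the unkilled operator are subtractive. [folklore] -/
theorem full_iterate_sub (hΨ : ∀ f x, Ψ f x = (∑ y ∈ N x, f y) / ((N x).card : ℝ)) (T : ℕ) :
    ∀ f g : V → ℝ, (Ψ^[T] fun y => f y - g y) = fun x => (Ψ^[T] f) x - (Ψ^[T] g) x := by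
  induction T with
  | zero => intro f g; rfl
  | succ T ih =>
    intro f g
    rw [Function.iterate_succ_apply, Function.iterate_succ_apply, Function.iterate_succ_apply,
      full_sub hΨ, ih]

end Kernel

end AntiConcentration

open AntiConcentration in
/-- **`DT_of_AC` — deterministic-time displacement of the KILLED walk from anti-concentration of the
unkilled one.**  With stub D's `c` and `C₀ := 480`: `K, N` and, for `n ≥ max N 1`, a time `T` with
`480 T ≤ c (Kn)²` and `∫ (𝒫^T 1_A)(0) ≥ 2c`; then `∫ (𝒦^T 1_A)(0) ≥ ∫ 𝒫^T 1_A(0) - ∫ (1 - 𝒦^T 1(0)) ≥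
2c - 480T/(Kn)² ≥ c` by the kernel inequality, `𝒫^T 1 ≤ 1`, `deg ≥ 1` a.s. on `{0↔∞}` and the exit-time
bound at `m := Kn`. -/
theorem DT_of_AC :
    (0 < theta (zdGraph 3) (0 : Site 3) (criticalProbI 3) →
    ∃ c : ℝ, 0 < c ∧ ∀ C₀ : ℝ, 0 < C₀ → ∃ K : ℕ, 0 < K ∧ ∃ N : ℕ, ∀ n ≥ N, ∃ T : ℕ,
      C₀ * (T : ℝ) ≤ c * (((K * n : ℕ) : ℝ) ^ 2) ∧
      ∀ Pop : BondConfig (Site 3) → (Site 3 → ℝ) → Site 3 → ℝ,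
        (∀ ω (g : Site 3 → ℝ) (x : Site 3), Pop ω g x =
          (∑ y ∈ ((zdGraph 3).neighborFinset x).filter (fun y => s(x, y) ∈ ω), g y) /
            ((((zdGraph 3).neighborFinset x).filter (fun y => s(x, y) ∈ ω)).card : ℝ)) →
        2 * c ≤ ∫ ω in percolatesAt (0 : Site 3),
            ((Pop ω)^[T] (fun x => if (n : ℤ) ≤ x 0 then (1 : ℝ) else 0)) 0
            ∂(bondPercolation (zdGraph 3) (criticalProbI 3))) →
    (0 < theta (zdGraph 3) (0 : Site 3) (criticalProbI 3) →
    ∃ K : ℕ, 0 < K ∧ ∃ c : ℝ, 0 < c ∧ ∃ N : ℕ, ∀ n ≥ N, ∃ T : ℕ,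
      ∀ Kop : BondConfig (Site 3) → (Site 3 → ℝ) → Site 3 → ℝ,
        (∀ ω (g : Site 3 → ℝ) (x : Site 3), Kop ω g x =
          if -((K * n : ℕ) : ℤ) < x 0 ∧ x 0 < ((K * n : ℕ) : ℤ) then
            (∑ y ∈ ((zdGraph 3).neighborFinset x).filter (fun y => s(x, y) ∈ ω), g y) /
              ((((zdGraph 3).neighborFinset x).filter (fun y => s(x, y) ∈ ω)).card : ℝ)
          else 0) →
        c ≤ ∫ ω in percolatesAt (0 : Site 3),
            ((Kop ω)^[T] (fun x => if (n : ℤ) ≤ x 0 then (1 : ℝ) else 0)) 0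
            ∂(bondPercolation (zdGraph 3) (criticalProbI 3))) := by

  intro hD hθ
  have hExit := stub_exitTimeBound stub_forwardKolmogorov stub_pathReversal
  obtain ⟨c, hc, hD'⟩ := hD hθ
  obtain ⟨K, hK, N, hN⟩ := hD' 480 (by norm_num)
  refine ⟨K, hK, c, hc, max N 1, ?_⟩
  intro n hn
  have hNn : N ≤ n := le_trans (le_max_left _ _) hn
  have hn0 : 0 < n := le_trans (le_max_right _ _) hn
  have hKn : 0 < K * n := Nat.mul_pos hK hn0
  obtain ⟨T, hT, hAC⟩ := hN n hNn
  refine ⟨T, ?_⟩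
  intro Kop hKop
  set P := bondPercolation (zdGraph 3) (criticalProbI 3) with hPdef
  -- the unkilled operator
  obtain ⟨Pop, hPop⟩ : ∃ Pop : BondConfig (Site 3) → (Site 3 → ℝ) → Site 3 → ℝ,
      ∀ ω (g : Site 3 → ℝ) (x : Site 3), Pop ω g x =
        (∑ y ∈ ((zdGraph 3).neighborFinset x).filter (fun y => s(x, y) ∈ ω), g y) /
          ((((zdGraph 3).neighborFinset x).filter (fun y => s(x, y) ∈ ω)).card : ℝ) :=
    ⟨fun ω g x => (∑ y ∈ ((zdGraph 3).neighborFinset x).filter (fun y => s(x, y) ∈ ω), g y) /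
          ((((zdGraph 3).neighborFinset x).filter (fun y => s(x, y) ∈ ω)).card : ℝ), fun _ _ _ => rfl⟩
  have hAC' := hAC Pop hPop
  -- stub C at `m := K n`
  have hEx : ∫ ω in percolatesAt (0 : Site 3),
      ((((zdGraph 3).neighborFinset (0 : Site 3)).filter
          (fun y => s((0 : Site 3), y) ∈ ω)).card : ℝ) * (1 - ((Kop ω)^[T] (fun _ => (1 : ℝ))) 0) ∂P ≤
      480 * (T : ℝ) / ((((K * n : ℕ) : ℕ) : ℝ) ^ 2) :=
    hExit (K * n) T hKn Kop (fun ω g x => by rw [hKop ω g x])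
  -- names
  set A : Site 3 → ℝ := fun x => if (n : ℤ) ≤ x 0 then (1 : ℝ) else 0 with hAdef
  have hA01 : ∀ x, 0 ≤ A x ∧ A x ≤ 1 := fun x => by
    simp only [hAdef]; split_ifs <;> norm_num
  set deg : BondConfig (Site 3) → ℝ := fun ω =>
    ((((zdGraph 3).neighborFinset (0 : Site 3)).filter (fun y => s((0 : Site 3), y) ∈ ω)).card : ℝ)
    with hdegdef
  have hdeg0 : ∀ ω, 0 ≤ deg ω := fun ω => Nat.cast_nonneg _
  have hdeg6 : ∀ ω, deg ω ≤ 6 := fun ω => DeterministicTime.deg_le_six ω 0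
  -- pointwise kernel inequality: `𝒦^T A ≥ 𝒫^T A - (𝒫^T 1 - 𝒦^T 1)`
  have hker : ∀ ω, ((Pop ω)^[T] A) 0 -
      (((Pop ω)^[T] (fun _ => (1 : ℝ))) 0 - ((Kop ω)^[T] (fun _ => (1 : ℝ))) 0) ≤
      ((Kop ω)^[T] A) 0 := by
    intro ω
    have h1 : ((Kop ω)^[T] fun y => (1 : ℝ) - A y) 0 ≤ ((Pop ω)^[T] fun y => (1 : ℝ) - A y) 0 :=
      DeterministicTime.killed_iterate_le_full (hKop ω) (hPop ω) T (fun y => sub_nonneg.2 (hA01 y).2) 0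
    have h2 : ((Kop ω)^[T] fun y => (1 : ℝ) - A y) =
        fun x => ((Kop ω)^[T] (fun _ => (1 : ℝ))) x - ((Kop ω)^[T] A) x :=
      DeterministicTime.killed_iterate_sub (hKop ω) T (fun _ => (1 : ℝ)) A
    have h3 : ((Pop ω)^[T] fun y => (1 : ℝ) - A y) =
        fun x => ((Pop ω)^[T] (fun _ => (1 : ℝ))) x - ((Pop ω)^[T] A) x :=
      full_iterate_sub (hPop ω) T (fun _ => (1 : ℝ)) A
    rw [h2, h3] at h1
    simp only at h1
    linarith
  -- bounds and measurability
  have b_PA : ∀ ω, 0 ≤ ((Pop ω)^[T] A) 0 ∧ ((Pop ω)^[T] A) 0 ≤ 1 := fun ω =>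
    DeterministicTime.full_iterate_mem_Icc (hPop ω) T hA01 0
  have b_P1 : ∀ ω, 0 ≤ ((Pop ω)^[T] (fun _ => (1 : ℝ))) 0 ∧ ((Pop ω)^[T] (fun _ => (1 : ℝ))) 0 ≤ 1 :=
    fun ω => DeterministicTime.full_iterate_mem_Icc (hPop ω) T (fun _ => ⟨zero_le_one, le_rfl⟩) 0
  have b_KA : ∀ ω, 0 ≤ ((Kop ω)^[T] A) 0 ∧ ((Kop ω)^[T] A) 0 ≤ 1 := fun ω =>
    DeterministicTime.killed_iterate_mem_Icc (hKop ω) T hA01 0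
  have b_K1 : ∀ ω, 0 ≤ ((Kop ω)^[T] (fun _ => (1 : ℝ))) 0 ∧ ((Kop ω)^[T] (fun _ => (1 : ℝ))) 0 ≤ 1 :=
    fun ω => DeterministicTime.killed_iterate_mem_Icc (hKop ω) T (fun _ => ⟨zero_le_one, le_rfl⟩) 0
  have m_PA : Measurable fun ω => ((Pop ω)^[T] A) 0 :=
    DeterministicTime.measurable_full_iterate (F := fun _ => A) (fun _ => measurable_const) hPop T 0
  have m_P1 : Measurable fun ω => ((Pop ω)^[T] (fun _ => (1 : ℝ))) 0 :=
    DeterministicTime.measurable_full_iterate (F := fun _ _ => (1 : ℝ)) (fun _ => measurable_const)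
      hPop T 0
  have m_KA : Measurable fun ω => ((Kop ω)^[T] A) 0 :=
    DeterministicTime.measurable_killed_iterate (F := fun _ => A) (fun _ => measurable_const) hKop T 0
  have m_K1 : Measurable fun ω => ((Kop ω)^[T] (fun _ => (1 : ℝ))) 0 :=
    DeterministicTime.measurable_killed_iterate (F := fun _ _ => (1 : ℝ)) (fun _ => measurable_const)
      hKop T 0
  have hdeg_meas : Measurable deg := StubStationarity.measurable_card_filter_zero
  have hint1 : ∀ X : BondConfig (Site 3) → ℝ, Measurable X → (∀ ω, 0 ≤ X ω ∧ X ω ≤ 1) →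
      Integrable X P := fun X hX hb => StubStationarity.integrable_of_bounds hX hb P
  have i_PA := hint1 _ m_PA b_PA
  have i_KA := hint1 _ m_KA b_KA
  have i_loss : Integrable (fun ω => 1 - ((Kop ω)^[T] (fun _ => (1 : ℝ))) 0) P :=
    (integrable_const 1).sub (hint1 _ m_K1 b_K1)
  have i_loss' : Integrable
      (fun ω => ((Pop ω)^[T] (fun _ => (1 : ℝ))) 0 - ((Kop ω)^[T] (fun _ => (1 : ℝ))) 0) P :=
    (hint1 _ m_P1 b_P1).sub (hint1 _ m_K1 b_K1)
  have i_dloss : Integrable (fun ω => deg ω * (1 - ((Kop ω)^[T] (fun _ => (1 : ℝ))) 0)) P := by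
    refine Integrable.of_bound (hdeg_meas.mul ((measurable_const).sub m_K1)).aestronglyMeasurable 6
      (Eventually.of_forall fun ω => ?_)
    have h0 : 0 ≤ 1 - ((Kop ω)^[T] (fun _ => (1 : ℝ))) 0 := sub_nonneg.2 (b_K1 ω).2
    have h1 : 1 - ((Kop ω)^[T] (fun _ => (1 : ℝ))) 0 ≤ 1 := by linarith [(b_K1 ω).1]
    rw [Real.norm_eq_abs, abs_of_nonneg (mul_nonneg (hdeg0 ω) h0)]
    calc deg ω * (1 - ((Kop ω)^[T] (fun _ => (1 : ℝ))) 0) ≤ 6 * 1 :=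
          mul_le_mul (hdeg6 ω) h1 h0 (by norm_num)
      _ = 6 := by norm_num
  have hS : MeasurableSet (percolatesAt (0 : Site 3) : Set (BondConfig (Site 3))) :=
    measurableSet_percolatesAt_holds 0
  -- (1) `∫ 𝒦^T A ≥ ∫ 𝒫^T A - ∫ (𝒫^T 1 - 𝒦^T 1)`
  have j1 : (∫ ω in percolatesAt (0 : Site 3), ((Pop ω)^[T] A) 0 ∂P) -
      (∫ ω in percolatesAt (0 : Site 3),
        (((Pop ω)^[T] (fun _ => (1 : ℝ))) 0 - ((Kop ω)^[T] (fun _ => (1 : ℝ))) 0) ∂P) ≤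
      ∫ ω in percolatesAt (0 : Site 3), ((Kop ω)^[T] A) 0 ∂P := by
    rw [← integral_sub i_PA.integrableOn i_loss'.integrableOn]
    exact setIntegral_mono (i_PA.sub i_loss').integrableOn i_KA.integrableOn (fun ω => hker ω)
  -- (2) `∫ (𝒫^T 1 - 𝒦^T 1) ≤ ∫ (1 - 𝒦^T 1) ≤ ∫ deg (1 - 𝒦^T 1)`
  have j2 : ∫ ω in percolatesAt (0 : Site 3),
        (((Pop ω)^[T] (fun _ => (1 : ℝ))) 0 - ((Kop ω)^[T] (fun _ => (1 : ℝ))) 0) ∂P ≤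
      ∫ ω in percolatesAt (0 : Site 3), (1 - ((Kop ω)^[T] (fun _ => (1 : ℝ))) 0) ∂P :=
    setIntegral_mono i_loss'.integrableOn i_loss.integrableOn
      (fun ω => sub_le_sub_right (b_P1 ω).2 _)
  have j3 : ∫ ω in percolatesAt (0 : Site 3), (1 - ((Kop ω)^[T] (fun _ => (1 : ℝ))) 0) ∂P ≤
      ∫ ω in percolatesAt (0 : Site 3), deg ω * (1 - ((Kop ω)^[T] (fun _ => (1 : ℝ))) 0) ∂P := by
    refine setIntegral_mono_on_ae i_loss.integrableOn i_dloss.integrableOn hS ?_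
    filter_upwards [DeterministicTime.one_le_deg_ae] with ω hω hmem
    have h1 : (1 : ℝ) ≤ deg ω := hω hmem
    have h0 : 0 ≤ 1 - ((Kop ω)^[T] (fun _ => (1 : ℝ))) 0 := sub_nonneg.2 (b_K1 ω).2
    nlinarith
  -- (3) stub C: `∫ deg (1 - 𝒦^T 1) ≤ 480 T/(Kn)² ≤ c`
  have hKnpos : (0 : ℝ) < ((K * n : ℕ) : ℝ) := by exact_mod_cast hKn
  have j4 : 480 * (T : ℝ) / ((((K * n : ℕ) : ℕ) : ℝ) ^ 2) ≤ c := by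
    rw [div_le_iff₀ (by positivity)]
    simpa using hT
  -- (4) stub D: `2c ≤ ∫ 𝒫^T A`
  have j5 : 2 * c ≤ ∫ ω in percolatesAt (0 : Site 3), ((Pop ω)^[T] A) 0 ∂P := by
    simpa only [hAdef] using hAC'
  -- conclusion
  have : c ≤ ∫ ω in percolatesAt (0 : Site 3), ((Kop ω)^[T] A) 0 ∂P := by linarith
  simpa only [hAdef] using this


/-- **stub `stub_VGRofAC` of line `registered` (rev 8; exact registered signature): the crux
`VerticalGamblersRuin` from annealed anti-concentration at one deterministic time** — `stub_DTC ∘ DT_of_AC`. -/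
theorem stub_VGRofAC :
    (0 < theta (zdGraph 3) (0 : Site 3) (criticalProbI 3) →
    ∃ c : ℝ, 0 < c ∧ ∀ C₀ : ℝ, 0 < C₀ → ∃ K : ℕ, 0 < K ∧ ∃ N : ℕ, ∀ n ≥ N, ∃ T : ℕ,
      C₀ * (T : ℝ) ≤ c * (((K * n : ℕ) : ℝ) ^ 2) ∧
      ∀ Pop : BondConfig (Site 3) → (Site 3 → ℝ) → Site 3 → ℝ,
        (∀ ω (g : Site 3 → ℝ) (x : Site 3), Pop ω g x =
          (∑ y ∈ ((zdGraph 3).neighborFinset x).filter (fun y => s(x, y) ∈ ω), g y) /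
            ((((zdGraph 3).neighborFinset x).filter (fun y => s(x, y) ∈ ω)).card : ℝ)) →
        2 * c ≤ ∫ ω in percolatesAt (0 : Site 3),
            ((Pop ω)^[T] (fun x => if (n : ℤ) ≤ x 0 then (1 : ℝ) else 0)) 0
            ∂(bondPercolation (zdGraph 3) (criticalProbI 3))) →
    Summit.CriticalPhenomena.PercolationContinuityZ3.Theses.PercGamblersRuin.VerticalGamblersRuin := by
  intro hAC
  exact stub_DTC (DT_of_AC hAC)

end Summit.CriticalPhenomena.PercolationContinuityZ3.Theorems.VerticalGamblersRuin

end
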